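import Mathlib
import Summits.HodgeConjecture.HodgeConjecture.Theorems.HodgeLocusCensusEmbDimOne
import HarnessLib
import HarnessLib.Audit.Tags

/-!
# HodgeLocusCensusLengthCertificate — what a 'FAT POINT of length L' certificate certifies

HONEST FRAMING (verbatim, pub-hlocus cell): certified instances and evidence bearing on the general
Hodge conjecture; no claim.

DICTIONARY (cell files `data/ivhs/census/og81/g12/g12_spectrum.json` 'what', `CENSUS-SUMMARY.md` §2
row O8, engine A `og11_curve`, engine B block 'second kernel').  On an `e = 1` row the slice germ is
presented inside the formal curve `K⟦u⟧` (curve-restriction driver) by the RESTRICTED PERIOD EQUATIONS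
`S ⊆ K⟦u⟧`; the certificate 'FAT POINT of length `L`' is: every restricted equation vanishes to order
`≥ L` (all `u^i`-coefficients, `i < L`, are zero) AND one of them has a NON-ZERO `u^L`-coefficient.
This module checks that such a certificate determines the slice germ completely:
the ideal is `(u^L)` and the length (`K`-dimension of `K⟦u⟧ ⧸ (S)`) is exactly `L`.
('`N`-smooth to order `N`' = all coefficients below `N+1` vanish = length `≥ N+1` or a curve, is the
complementary reading and is not a certificate of anything final; not treated here.)

What the kernel checks (over any field `K`; no definitions):
* `X_pow_mem_span_of_order_eq` — an `f` with `order f = L` generates `u^L`: `u^L ∈ (f)`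
  (`f = u^L · (unit)`, Mathlib `X_pow_order_mul_divXPowOrder`, `isUnit_divided_by_X_pow_order`).
* `span_eq_span_X_pow_of_certificate` — if every `g ∈ S` is divisible by `u^L` and some `f ∈ S` has
  `order f = L`, then `Ideal.span S = (u^L)`.
* `certificate_iff_coeff` — the certificate in coefficient language: `(∀ i < L, coeff i g = 0) ↔ u^L ∣ g`
  and `order f = L ↔ (coeff L f ≠ 0 ∧ ∀ i < L, coeff i f = 0)` (Mathlib `X_pow_dvd_iff`, `order_eq_nat`).
* `finrank_quotient_of_certificate` — then `dim_K K⟦u⟧ ⧸ (S) = L` (by `finrank_quotient_span_X_pow`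
  of `HodgeLocusCensusEmbDimOne`).
NOT formalised: the restriction of the period equations to the curve parameter (engines), e = 1, and all
Hodge theory.
-/

namespace Summit.HodgeConjecture.HodgeConjecture.HodgeLocus.Census

open PowerSeries

variable {K : Type*} [Field K]

/-- An equation of order exactly `L` generates `u^L`. -/
theorem X_pow_mem_span_of_order_eq {f : K⟦X⟧} {L : ℕ} (hf : f.order = L) :
    (X : K⟦X⟧) ^ L ∈ Ideal.span {f} := by
  have hf0 : f ≠ 0 := by
    intro h
    rw [h, order_zero] at hf
    exact (ENat.coe_ne_top L) hf.symm
  have hL : f.order.toNat = L := by rw [hf]; rfl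
  obtain ⟨u, hu⟩ := isUnit_divided_by_X_pow_order hf0
  have hfac : (X : K⟦X⟧) ^ L * divXPowOrder f = f := by
    rw [← hL]; exact X_pow_order_mul_divXPowOrder
  rw [Ideal.mem_span_singleton]
  refine ⟨↑u⁻¹, ?_⟩
  rw [← hfac, ← hu, mul_assoc, Units.mul_inv, mul_one]

/-- **Certificate ⇒ ideal.**  If every restricted equation `g ∈ S` is divisible by `u^L` and one of
them, `f`, has order exactly `L`, then the ideal they generate is `(u^L)`. -/
theorem span_eq_span_X_pow_of_certificate (S : Set K⟦X⟧) (L : ℕ)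
    (hdiv : ∀ g ∈ S, (X : K⟦X⟧) ^ L ∣ g) {f : K⟦X⟧} (hfS : f ∈ S) (hf : f.order = L) :
    Ideal.span S = Ideal.span {(X : K⟦X⟧) ^ L} := by
  apply le_antisymm
  · rw [Ideal.span_le]
    intro g hg
    exact Ideal.mem_span_singleton.mpr (hdiv g hg)
  · rw [Ideal.span_le, Set.singleton_subset_iff]
    exact Ideal.span_mono (Set.singleton_subset_iff.mpr hfS) (X_pow_mem_span_of_order_eq hf)

/-- The certificate in the language the engines print (coefficients): vanishing below `L` is
divisibility by `u^L`, and 'first non-zero coefficient at `u^L`' is `order = L`. -/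
theorem certificate_iff_coeff (g f : K⟦X⟧) (L : ℕ) :
    ((∀ i < L, coeff i g = 0) ↔ (X : K⟦X⟧) ^ L ∣ g) ∧
      (f.order = L ↔ (coeff L f ≠ 0 ∧ ∀ i < L, coeff i f = 0)) :=
  ⟨(X_pow_dvd_iff).symm, order_eq_nat⟩

/-- **Certificate ⇒ length.**  Under the certificate hypotheses the slice germ `K⟦u⟧ ⧸ (S)` has
`K`-dimension exactly `L`. -/
theorem finrank_quotient_of_certificate (S : Set K⟦X⟧) (L : ℕ)
    (hdiv : ∀ g ∈ S, (X : K⟦X⟧) ^ L ∣ g) {f : K⟦X⟧} (hfS : f ∈ S) (hf : f.order = L) :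
    Module.finrank K (K⟦X⟧ ⧸ Ideal.span S) = L := by
  rw [span_eq_span_X_pow_of_certificate S L hdiv hfS hf]
  exact finrank_quotient_span_X_pow L

end Summit.HodgeConjecture.HodgeConjecture.HodgeLocus.Census
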